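import Mathlib.Combinatorics.Additive.Corner.Roth
import Mathlib.Algebra.BigOperators.Expect
import Mathlib.Algebra.Order.BigOperators.Expect
import Mathlib.Data.ZMod.Basic
import Mathlib.Order.Filter.AtTopBot.Basic
import Mathlib.Tactic.IntervalCases
import Mathlib.Tactic.Positivity
import Mathlib.Tactic.FieldSimp
import Literature.Combinatorics.Additive.SzemerediTheorem
import HarnessLib

/-!
# Szemerédi's theorem: finitary form, Varnavides averaging, weighted form (CFZ §§2–4)

Topic `Literature/Combinatorics/Additive`. Sources: D. Conlon, J. Fox, Y. Zhao, *The Green–Tao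
theorem: an exposition*, EMS Surv. Math. Sci. 1 (2014), 249–282 = arXiv:1403.2957 (held as
`paper:arxiv-1403.2957`; numbers are those of the arXiv version), §2 (the finitary form of
Szemerédi's theorem), §3 (Thm. 3.1 ⇒ Thm. 3.2 "by a simple averaging argument (attributed to
Varnavides)", Thm. 3.2 ⇒ Thm. 3.3, p. 7) and §4 (Thm. 4.1, the weighted Szemerédi theorem);
E. Szemerédi, Acta Arith. 27 (1975); P. Varnavides, J. London Math. Soc. 34 (1959).

This file is the bottom layer of the decomposition of the named fact
`Literature.Combinatorics.Additive.CFZ.RelativeSzemeredi` (CFZ Thm. 4.3): the tree proves Thm. 4.3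
from Thm. 4.1 (`Literature.Combinatorics.Additive.CFZ.relativeSzemeredi_of`, with the dense model
theorem and the counting lemma discharged), and Thm. 4.1 is Szemerédi's theorem. Here:

* `SzemerediFinitary k` — NAMED FACT (parametrised by the length `k`): Szemerédi's theorem in
  finitary form — paraphrasing, for every `δ > 0` every `A ⊆ [M]` with `|A| ≥ δ M` contains a
  `k`-AP once `M` is sufficiently large (CFZ §2 print the finitary form as "every `k`-AP-free
  subset of `[N]` has `o(N)` elements", and state Roth's theorem, Thm. 3.1, in `ℤ_N` for `k = 3`;
  the `[M]`-form and the `ℤ_N`-forms are provably equivalent here, `szemerediFinitary_iff_weighted`).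
  We index `[M]` as `{0, …, M-1}`. It is exactly the `k`-slice of the tree's bundled named fact
  `Literature.Combinatorics.Additive.SzemerediTheorem` (`= ∀ k ≥ 1, SzemerediFinitary k` by `rfl`,
  `szemerediTheorem_iff`; bridges `szemerediFinitary_of_szemerediTheorem`,
  `szemerediWeighted_of_szemerediTheorem`); the per-`k` form is kept because `k ≤ 3` is proved;
* `szemerediFinitary_three` — the case `k = 3` (Roth's theorem in `[M]`-form; CFZ state it in
  `ℤ_N` as Thm. 3.1) PROVED from Mathlib's `roth_3ap_theorem_nat`; `szemerediFinitary_of_le_two` —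
  the trivial cases `k ≤ 2`;
* `SzemerediWeighted k` — the weighted form, CFZ Thm. 4.1 at length `k` (for `k = 3` Thm. 3.3),
  literally the `k`-slice of the tree's `Literature.NumberTheory.Sieve.GreenTao2008.SzemerediExpectation`
  (Green–Tao 2008, Prop. 2.3), `N → ∞` through all moduli;
* `szemerediWeighted_of_finitary : SzemerediFinitary k → SzemerediWeighted k` — PROVED:
  Varnavides' averaging over the sub-progressions `a, a+d, …, a+(M-1)d` of `ℤ_N`
  (`Varnavides.le_card_apPairs`, CFZ Thm. 3.1 ⇒ 3.2 for general `k`, with the explicit constant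
  `c = δ/(4M³)`, `M = M(k, δ/2)`), followed by the passage to weights of CFZ p. 7 (printed there
  for `k = 3`: `A = {x : f(x) ≥ δ/2}` has `|A| ≥ δN/2` and `𝔼[f f f] ≥ (δ/2)³ 𝔼[1_A 1_A 1_A]`).

Consequently `SzemerediWeighted 3` (CFZ Thm. 3.3) holds unconditionally (`szemerediWeighted_three`).
Conversely `szemerediFinitary_of_weighted` (embed `[M]` in `ℤ_{2M}`, "so that no `k`-APs wrap around
zero", CFZ §2) gives `SzemerediFinitary k ↔ SzemerediWeighted k` (`szemerediFinitary_iff_weighted`).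
The general case `k ≥ 4` of `SzemerediFinitary` (equivalently of `SzemerediTheorem`) is Szemerédi's
theorem proper, not yet formalised; it stays a named fact.

Design: the Varnavides step is carried out for every modulus `N ≥ 2M` (not only primes), with
integer common differences `1 ≤ d ≤ N/M`, so that the `M` indices of a sub-progression are read
in `ℕ` and a `k`-AP of indices is a `k`-AP of `ℤ_N`; trivial progressions (`r = 0`) are counted, as
in the expectation `𝔼_{x,r ∈ ℤ_N}` of Thms. 3.3/4.1.

## References
* D. Conlon, J. Fox, Y. Zhao, *The Green–Tao theorem: an exposition*, EMS Surv. Math. Sci. 1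
  (2014), 249–282, §2, Thms. 3.1–3.3, Thm. 4.1. [cite: ConlonFoxZhao2014]
* E. Szemerédi, *On sets of integers containing no `k` elements in arithmetic progression*, Acta
  Arith. 27 (1975), 199–245. [cite: Szemeredi1975]
* P. Varnavides, *On certain sets of positive density*, J. London Math. Soc. 34 (1959), 358–360.
  [cite: Varnavides1959]
-/

noncomputable section

open Filter Finset
open scoped BigOperators

namespace Literature.Combinatorics.Additive

/-! ### The two forms of Szemerédi's theorem -/

/-- **Szemerédi's theorem, finitary form, for progressions of length `k`** (Szemerédi 1975, Main
Theorem `r_k(n) = o(n)`; paraphrasing: for every `δ > 0`, every `A ⊆ [M]` with `|A| ≥ δ M` contains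
a `k`-AP once `M` is sufficiently large — CFZ §2 print it as "every `k`-AP-free subset of `[N]` has
`o(N)` elements" and state the case `k = 3` in `ℤ_N`, Thm. 3.1; equivalent forms by
`szemerediFinitary_iff_weighted`). Here `[M]` is `{0, …, M-1} = Finset.range M` and a `k`-AP is
`a, a+d, …, a+(k-1)d` with `d > 0`. Named fact, parametrised by `k` — the `k`-slice of the bundled
`Literature.Combinatorics.Additive.SzemerediTheorem` (`szemerediTheorem_iff`); proved below for
`k ≤ 3`. [cite: Szemeredi1975, Main Theorem (finitary form)] -/
def SzemerediFinitary (k : ℕ) : Prop :=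
  ∀ δ : ℝ, 0 < δ → ∃ M₀ : ℕ, ∀ M : ℕ, M₀ ≤ M → ∀ A : Finset ℕ, A ⊆ range M →
    δ * M ≤ (A.card : ℝ) → ∃ a d : ℕ, 0 < d ∧ ∀ j < k, a + j * d ∈ A

/-- **Szemerédi's theorem, weighted form, at length `k`** (CFZ Thm. 4.1; Thm. 3.3 for `k = 3`;
Green–Tao 2008 Prop. 2.3): for every `0 < δ ≤ 1` there is `c = c(k, δ) > 0` such that every
`f : ℤ_N → [0,1]` with `𝔼 f ≥ δ` satisfies `𝔼_{x,r ∈ ℤ_N}[f(x) f(x+r) ⋯ f(x+(k-1)r)] ≥ c - o_{k,δ}(1)`.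
This is literally the `k`-slice of `Literature.NumberTheory.Sieve.GreenTao2008.SzemerediExpectation`.
[cite: ConlonFoxZhao2014, Theorem 4.1] -/
def SzemerediWeighted (k : ℕ) : Prop :=
  ∀ δ : ℝ, 0 < δ → δ ≤ 1 → ∃ c : ℝ, 0 < c ∧ ∀ η : ℝ, 0 < η →
    ∀ᶠ N : ℕ in atTop, ∀ [NeZero N], ∀ f : ZMod N → ℝ,
      (∀ x, 0 ≤ f x) → (∀ x, f x ≤ 1) → δ ≤ 𝔼 x, f x →
        c - η ≤ 𝔼 x : ZMod N, 𝔼 r : ZMod N, ∏ i : Fin k, f (x + (i : ℕ) * r)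

/-! ### Small lengths: `k ≤ 2` trivially, `k = 3` from Mathlib's Roth theorem -/

/-- Lengths `k ≤ 2`: any set with at least two elements contains a `2`-AP. [folklore] -/
theorem szemerediFinitary_of_le_two {k : ℕ} (hk : k ≤ 2) : SzemerediFinitary k := by
  intro δ hδ
  refine ⟨⌊1 / δ⌋₊ + 1, fun M hM A hAM hA => ?_⟩
  -- `δ M > 1`, so `A` has at least two elements
  have hM1 : (1 : ℝ) < δ * M := by
    have h1 : 1 / δ < (⌊1 / δ⌋₊ : ℝ) + 1 := Nat.lt_floor_add_one _
    have h2 : (⌊1 / δ⌋₊ : ℝ) + 1 ≤ M := by exact_mod_cast hM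
    calc (1 : ℝ) = δ * (1 / δ) := by field_simp
      _ < δ * M := by exact mul_lt_mul_of_pos_left (h1.trans_le h2) hδ
  have hA2 : 1 < A.card := by exact_mod_cast hM1.trans_le hA
  obtain ⟨a, ha, b, hb, hab⟩ := Finset.one_lt_card.mp hA2
  wlog hlt : a < b generalizing a b
  · exact this b hb a ha (Ne.symm hab) (lt_of_le_of_ne (not_lt.mp hlt) (Ne.symm hab))
  refine ⟨a, b - a, by omega, fun j hj => ?_⟩
  have hj2 : j < 2 := lt_of_lt_of_le hj hk
  interval_cases j
  · simpa using ha
  · have : a + 1 * (b - a) = b := by omega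
    rw [this]; exact hb

/-- **Roth's theorem**, the case `k = 3` of the finitary Szemerédi theorem, in `[M]`-form (CFZ
state it in `ℤ_N` as Thm. 3.1; the two forms are equivalent by `szemerediFinitary_iff_weighted`),
from Mathlib's `roth_3ap_theorem_nat` (the corners / triangle-removal proof).
[cite: ConlonFoxZhao2014, Theorem 3.1 (in `[M]`-form)] -/
theorem szemerediFinitary_three : SzemerediFinitary 3 := by
  intro δ hδ
  refine ⟨cornersTheoremBound (δ / 3), fun M hM A hAM hA => ?_⟩
  have h := roth_3ap_theorem_nat δ hδ hM A hAM hA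
  unfold ThreeAPFree at h
  push Not at h
  obtain ⟨a, ha, b, hb, c, hc, habc, hab⟩ := h
  rw [Finset.mem_coe] at ha hb hc
  rcases lt_or_gt_of_ne hab with hlt | hlt
  · refine ⟨a, b - a, by omega, fun j hj => ?_⟩
    interval_cases j
    · simpa using ha
    · have : a + 1 * (b - a) = b := by omega
      rw [this]; exact hb
    · have : a + 2 * (b - a) = c := by omega
      rw [this]; exact hc
  · refine ⟨c, b - c, by omega, fun j hj => ?_⟩
    interval_cases j
    · simpa using hc
    · have : c + 1 * (b - c) = b := by omega
      rw [this]; exact hb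
    · have : c + 2 * (b - c) = a := by omega
      rw [this]; exact ha

/-! ### Varnavides' averaging argument (CFZ Thm. 3.1 ⇒ Thm. 3.2, general `k`) -/

namespace Varnavides

variable {k : ℕ} {N : ℕ} [NeZero N]

/-- The pairs `(x, r) ∈ ℤ_N²` whose `k`-AP `x, x+r, …, x+(k-1)r` lies in `A` (trivial ones
included). [cite: ConlonFoxZhao2014, Theorem 3.2] -/
def apPairs (k : ℕ) (A : Finset (ZMod N)) : Finset (ZMod N × ZMod N) :=
  univ.filter fun p => ∀ i : Fin k, p.1 + ((i : ℕ) : ZMod N) * p.2 ∈ A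

/-- The indices `i < M` of the sub-progression `a, a+d, …, a+(M-1)d` of `ℤ_N` that land in `A`.
[cite: Varnavides1959, proof] -/
def apIdx (M : ℕ) (A : Finset (ZMod N)) (a : ZMod N) (d : ℕ) : Finset ℕ :=
  (range M).filter fun i => a + ((i : ℕ) : ZMod N) * ((d : ℕ) : ZMod N) ∈ A

/-- The starting points `a` whose sub-progression with difference `d` meets `A` in density
`≥ δ/2`. [cite: Varnavides1959, proof] -/
def goodSet (M : ℕ) (δ : ℝ) (A : Finset (ZMod N)) (d : ℕ) : Finset (ZMod N) :=
  univ.filter fun a => δ / 2 * M ≤ ((apIdx M A a d).card : ℝ)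

omit [NeZero N] in
/-- `apIdx ⊆ range M`. [folklore] -/
theorem apIdx_subset (M : ℕ) (A : Finset (ZMod N)) (a : ZMod N) (d : ℕ) :
    apIdx M A a d ⊆ range M :=
  filter_subset _ _

/-- Double counting: `∑_a |A ∩ P_{a,d}| = M |A|` (each index `i < M` contributes `|A|` by
translation invariance). [cite: Varnavides1959, proof] -/
theorem sum_card_apIdx (M : ℕ) (A : Finset (ZMod N)) (d : ℕ) :
    ∑ a : ZMod N, (apIdx M A a d).card = M * A.card := by
  classical
  unfold apIdx
  simp_rw [card_filter]
  rw [sum_comm]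
  have key : ∀ c : ZMod N, (∑ a : ZMod N, if a + c ∈ A then 1 else 0) = A.card := by
    intro c
    rw [Fintype.sum_equiv (Equiv.addRight c) (fun a => if a + c ∈ A then 1 else 0)
      (fun b => if b ∈ A then 1 else 0) (fun a => rfl)]
    rw [sum_boole, filter_univ_mem, Nat.cast_id]
  simp_rw [key, sum_const, card_range, smul_eq_mul]

/-- Many good starting points: if `|A| ≥ δ N` then, for every `d`, at least `δ N / 2` of the
`a ∈ ℤ_N` have `|A ∩ P_{a,d}| ≥ δ M / 2`. [cite: Varnavides1959, proof] -/
theorem le_card_goodSet {M : ℕ} (hM : 0 < M) {δ : ℝ} (hδ : 0 ≤ δ) {A : Finset (ZMod N)}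
    (hA : δ * N ≤ A.card) (d : ℕ) : δ / 2 * N ≤ (goodSet M δ A d).card := by
  classical
  set G := goodSet M δ A d with hG
  have key : ∑ a : ZMod N, ((apIdx M A a d).card : ℝ) = M * A.card := by
    exact_mod_cast sum_card_apIdx M A d
  have hsplit := sum_filter_add_sum_filter_not univ
    (fun a => δ / 2 * M ≤ ((apIdx M A a d).card : ℝ)) (fun a => ((apIdx M A a d).card : ℝ))
  have h1 : ∑ a ∈ univ.filter (fun a => δ / 2 * M ≤ ((apIdx M A a d).card : ℝ)),
      ((apIdx M A a d).card : ℝ) ≤ G.card * M := by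
    have : ∀ a ∈ univ.filter (fun a => δ / 2 * M ≤ ((apIdx M A a d).card : ℝ)),
        ((apIdx M A a d).card : ℝ) ≤ M := fun a _ => by
      exact_mod_cast (card_le_card (apIdx_subset M A a d)).trans (card_range M).le
    refine (sum_le_sum this).trans ?_
    rw [sum_const, nsmul_eq_mul, hG, goodSet]
  have h2 : ∑ a ∈ univ.filter (fun a => ¬ δ / 2 * M ≤ ((apIdx M A a d).card : ℝ)),
      ((apIdx M A a d).card : ℝ) ≤ N * (δ / 2 * M) := by
    have : ∀ a ∈ univ.filter (fun a => ¬ δ / 2 * M ≤ ((apIdx M A a d).card : ℝ)),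
        ((apIdx M A a d).card : ℝ) ≤ δ / 2 * M := fun a ha => (not_le.mp (mem_filter.mp ha).2).le
    refine (sum_le_sum this).trans ?_
    rw [sum_const, nsmul_eq_mul]
    refine mul_le_mul_of_nonneg_right ?_ ?_
    · exact_mod_cast (card_filter_le _ _).trans (by rw [card_univ, ZMod.card])
    · positivity
  have hMpos : (0 : ℝ) < M := by exact_mod_cast hM
  have h3 : (M : ℝ) * (δ * N) ≤ M * A.card := mul_le_mul_of_nonneg_left hA hMpos.le
  have h4 : (M : ℝ) * A.card ≤ G.card * M + N * (δ / 2 * M) := by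
    rw [← key, ← hsplit]; exact add_le_add h1 h2
  have h5 : (M : ℝ) * (δ / 2 * N) ≤ M * G.card := by nlinarith [h3, h4]
  exact le_of_mul_le_mul_left h5 hMpos


/-- The witnesses used in the counting: inside a dense `I ⊆ range M` a progression
`a, a+r, …, a+(k-1)r ⊆ I` with `a < M` and `0 < r < M` (for `k ≥ 2` any progression given by
Szemerédi's theorem qualifies; for `k ≤ 1` take `r = 1`). [folklore] -/
theorem exists_witness {M : ℕ} (hM : 2 ≤ M) {I : Finset ℕ} (hI : I ⊆ range M)
    (hIne : I.Nonempty) (hAP : ∃ a d : ℕ, 0 < d ∧ ∀ j < k, a + j * d ∈ I) :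
    ∃ w : ℕ × ℕ, w.1 < M ∧ 0 < w.2 ∧ w.2 < M ∧ ∀ j < k, w.1 + j * w.2 ∈ I := by
  rcases Nat.lt_or_ge k 2 with hk | hk
  · obtain ⟨i, hi⟩ := hIne
    refine ⟨(i, 1), mem_range.mp (hI hi), Nat.one_pos, by omega, fun j hj => ?_⟩
    have hj0 : j = 0 := by omega
    subst hj0
    simpa using hi
  · obtain ⟨a, d, hd, h⟩ := hAP
    have h0 := h 0 (by omega)
    have h1 := h 1 (by omega)
    simp only [zero_mul, add_zero, one_mul] at h0 h1
    have ha : a < M := mem_range.mp (hI h0)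
    have had : a + d < M := mem_range.mp (hI h1)
    exact ⟨(a, d), ha, hd, by omega, h⟩

/-- **The Varnavides injection.** If every dense `I ⊆ range M` carries a witness progression, and
`M L ≤ N`, then the good pairs `(a, d)`, `a ∈ ℤ_N`, `1 ≤ d ≤ L`, inject into
`apPairs × [M)²` via `(a, d) ↦ ((a + i₀ d, r d), (i₀, r))`: the total number of good pairs is at
most `M² · #apPairs`. [cite: Varnavides1959, proof] -/
theorem sum_card_goodSet_le {M L : ℕ} {δ : ℝ} {A : Finset (ZMod N)} (hML : M * L ≤ N)
    (hW : ∀ I ⊆ range M, δ / 2 * M ≤ (I.card : ℝ) →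
      ∃ w : ℕ × ℕ, w.1 < M ∧ 0 < w.2 ∧ w.2 < M ∧ ∀ j < k, w.1 + j * w.2 ∈ I) :
    ∑ d ∈ Icc 1 L, (goodSet M δ A d).card ≤ (apPairs k A).card * (M * M) := by
  classical
  -- the set of good pairs and its cardinality
  set G : Finset (ZMod N × ℕ) :=
    (univ ×ˢ Icc 1 L).filter fun p => δ / 2 * M ≤ ((apIdx M A p.1 p.2).card : ℝ) with hG
  have hcardG : G.card = ∑ d ∈ Icc 1 L, (goodSet M δ A d).card := by
    rw [hG, card_filter, sum_product_right]
    refine sum_congr rfl fun d _ => ?_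
    rw [goodSet, card_filter]
  rw [← hcardG, ← card_range M, ← card_product, ← card_product]
  -- witnesses
  have hW' : ∀ p : ZMod N × ℕ, δ / 2 * M ≤ ((apIdx M A p.1 p.2).card : ℝ) →
      ∃ w : ℕ × ℕ, w.1 < M ∧ 0 < w.2 ∧ w.2 < M ∧ ∀ j < k, w.1 + j * w.2 ∈ apIdx M A p.1 p.2 :=
    fun p hp => hW _ (apIdx_subset M A p.1 p.2) hp
  choose! wit hwit using hW'
  let θ : ZMod N × ℕ → (ZMod N × ZMod N) × (ℕ × ℕ) := fun p =>
    ((p.1 + ((wit p).1 : ZMod N) * (p.2 : ZMod N), ((wit p).2 : ZMod N) * (p.2 : ZMod N)), wit p)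
  refine card_le_card_of_injOn θ (fun p hp => ?_) ?_
  · -- `θ` maps good pairs into `apPairs × (range M × range M)`
    rw [hG, coe_filter] at hp
    obtain ⟨-, hp⟩ := hp
    obtain ⟨h1, -, h3, h4⟩ := hwit p hp
    simp only [coe_product, Set.mem_prod, mem_coe, mem_range]
    refine ⟨?_, h1, h3⟩
    simp only [apPairs, mem_filter, mem_univ, true_and, θ]
    intro i
    have := h4 i i.isLt
    simp only [apIdx, mem_filter] at this
    have e : p.1 + ((wit p).1 : ZMod N) * (p.2 : ZMod N) +
        ((i : ℕ) : ZMod N) * (((wit p).2 : ZMod N) * (p.2 : ZMod N)) =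
        p.1 + (((wit p).1 + (i : ℕ) * (wit p).2 : ℕ) : ZMod N) * (p.2 : ZMod N) := by
      push_cast; ring
    rw [e]; exact this.2
  · -- `θ` is injective on good pairs
    intro p hp q hq hpq
    rw [hG, coe_filter] at hp hq
    obtain ⟨hp0, hp⟩ := hp
    obtain ⟨hq0, hq⟩ := hq
    simp only [Finset.mem_product, mem_Icc, mem_univ, true_and] at hp0 hq0
    obtain ⟨-, h2, h3, -⟩ := hwit p hp
    simp only [θ, Prod.mk.injEq] at hpq
    obtain ⟨⟨hx, hr⟩, hw⟩ := hpq
    rw [hw] at hx hr h2 h3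
    -- `r d ≡ r d' (mod N)` with both sides `< N`
    have hlt : ∀ d : ℕ, 1 ≤ d → d ≤ L → (wit q).2 * d < N := fun d hd1 hd =>
      lt_of_lt_of_le (Nat.mul_lt_mul_of_lt_of_le h3 hd (by omega)) hML
    have hdd : p.2 = q.2 := by
      have h := hr
      rw [← Nat.cast_mul, ← Nat.cast_mul, ZMod.natCast_eq_natCast_iff',
        Nat.mod_eq_of_lt (hlt p.2 hp0.1 hp0.2), Nat.mod_eq_of_lt (hlt q.2 hq0.1 hq0.2)] at h
      exact Nat.eq_of_mul_eq_mul_left h2 h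
    rw [hdd] at hx
    exact Prod.ext (add_right_cancel hx) hdd

/-- **Varnavides' theorem for `k`-APs in `ℤ_N`** (CFZ Thm. 3.1 ⇒ Thm. 3.2 for general `k`): if
Szemerédi's theorem holds at length `k` then for every `δ > 0` there are `c > 0` and `N₀` with
`#{(x, r) ∈ ℤ_N² : x, x+r, …, x+(k-1)r ∈ A} ≥ c N²` whenever `N ≥ N₀` and `|A| ≥ δ N`. Constants:
`M = max(M(k, δ/2), 2)`, `c = δ/(4M³)`, `N₀ = 2M` (Varnavides 1959 for `k = 3`).
[cite: ConlonFoxZhao2014, Theorem 3.2 (Varnavides' averaging argument)] -/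
theorem le_card_apPairs (hS : SzemerediFinitary k) {δ : ℝ} (hδ : 0 < δ) :
    ∃ c : ℝ, 0 < c ∧ ∃ N₀ : ℕ, ∀ N : ℕ, N₀ ≤ N → ∀ [NeZero N] (A : Finset (ZMod N)),
      δ * N ≤ A.card → c * (N : ℝ) ^ 2 ≤ (apPairs k A).card := by
  obtain ⟨M₀, hM₀⟩ := hS (δ / 2) (half_pos hδ)
  set M : ℕ := max M₀ 2 with hMdef
  have hM2 : 2 ≤ M := le_max_right _ _
  have hMpos : (0 : ℝ) < M := by exact_mod_cast (lt_of_lt_of_le Nat.zero_lt_two hM2)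
  refine ⟨δ / (4 * (M : ℝ) ^ 3), by positivity, 2 * M, fun N hN _ A hA => ?_⟩
  -- witnesses at level `M`
  have hW : ∀ I ⊆ range M, δ / 2 * M ≤ (I.card : ℝ) →
      ∃ w : ℕ × ℕ, w.1 < M ∧ 0 < w.2 ∧ w.2 < M ∧ ∀ j < k, w.1 + j * w.2 ∈ I := by
    intro I hI hIcard
    have hIne : I.Nonempty := by
      rw [← Finset.card_pos]
      have : (0 : ℝ) < I.card := lt_of_lt_of_le (by positivity) hIcard
      exact_mod_cast this
    exact exists_witness hM2 hI hIne (hM₀ M (le_max_left _ _) I hI hIcard)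
  set L : ℕ := N / M with hLdef
  have hML : M * L ≤ N := Nat.mul_div_le N M
  have hNL : N ≤ 2 * (M * L) := by
    have h1 : N < M * (N / M + 1) := Nat.lt_mul_div_succ N (by omega)
    have h2 : M * (N / M + 1) = M * L + M := by rw [hLdef]; ring
    omega
  -- lower bound: `L · (δ/2) N ≤ ∑_d #goodSet`
  have hlow : (L : ℝ) * (δ / 2 * N) ≤ ∑ d ∈ Icc 1 L, ((goodSet M δ A d).card : ℝ) := by
    have h := fun d (_ : d ∈ Icc 1 L) => le_card_goodSet (lt_of_lt_of_le Nat.zero_lt_two hM2)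
      hδ.le hA d
    have := Finset.card_nsmul_le_sum (Icc 1 L) _ _ h
    rwa [Nat.card_Icc, Nat.add_sub_cancel, nsmul_eq_mul] at this
  -- upper bound: the injection
  have hup : ∑ d ∈ Icc 1 L, ((goodSet M δ A d).card : ℝ) ≤ (apPairs k A).card * (M * M) := by
    exact_mod_cast sum_card_goodSet_le hML hW
  -- combine
  have hL : (N : ℝ) ≤ 2 * (M * L) := by exact_mod_cast hNL
  have key : (N : ℝ) * (δ / 2 * N) ≤ 2 * M * ((apPairs k A).card * (M * M)) := by
    calc (N : ℝ) * (δ / 2 * N) ≤ 2 * (M * L) * (δ / 2 * N) := by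
          exact mul_le_mul_of_nonneg_right hL (by positivity)
      _ = 2 * M * (L * (δ / 2 * N)) := by ring
      _ ≤ 2 * M * ((apPairs k A).card * (M * M)) := by
          exact mul_le_mul_of_nonneg_left (hlow.trans hup) (by positivity)
  have e1 : (N : ℝ) * (δ / 2 * N) = δ * (N : ℝ) ^ 2 / 2 := by ring
  have e2 : (2 : ℝ) * M * ((apPairs k A).card * (M * M)) =
      (apPairs k A).card * (4 * (M : ℝ) ^ 3) / 2 := by ring
  rw [e1, e2] at key
  rw [div_mul_eq_mul_div, div_le_iff₀ (by positivity)]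
  linarith [key]

end Varnavides

/-! ### The weighted form (CFZ p. 7: Thm. 3.2 ⇒ Thm. 3.3, general `k`) -/

section weighted

variable {k : ℕ} {N : ℕ} [NeZero N]

/-- `𝔼_x 𝔼_r F(x, r) = (∑_{(x,r)} F) / N²` on `ℤ_N`. [folklore] -/
theorem expect_expect_eq_sum_div (F : ZMod N → ZMod N → ℝ) :
    𝔼 x : ZMod N, 𝔼 r : ZMod N, F x r = (∑ p : ZMod N × ZMod N, F p.1 p.2) / (N : ℝ) ^ 2 := by
  rw [← Finset.expect_product' univ univ F, univ_product_univ, Finset.expect_eq_sum_div_card,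
    card_univ, Fintype.card_prod, ZMod.card, Nat.cast_mul, sq]

/-- "If `𝔼 f ≥ δ` and `0 ≤ f ≤ 1`, then `|A| ≥ δ N / 2`" for `A = {x : f(x) ≥ δ/2}` (CFZ p. 7).
[cite: ConlonFoxZhao2014, Section 3 (p. 7)] -/
theorem le_card_filter_of_expect {δ : ℝ} (hδ : 0 ≤ δ) (f : ZMod N → ℝ) (hf1 : ∀ x, f x ≤ 1)
    (hfδ : δ ≤ 𝔼 x, f x) :
    δ / 2 * N ≤ ((univ.filter fun x => δ / 2 ≤ f x).card : ℝ) := by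
  classical
  set A := univ.filter fun x => δ / 2 ≤ f x with hA
  have hNpos : (0 : ℝ) < N := by exact_mod_cast Nat.pos_of_ne_zero (NeZero.ne N)
  have hsum : δ * N ≤ ∑ x, f x := by
    rw [Fintype.expect_eq_sum_div_card, ZMod.card, le_div_iff₀ hNpos] at hfδ
    exact hfδ
  have hsplit := sum_filter_add_sum_filter_not univ (fun x => δ / 2 ≤ f x) f
  have h1 : ∑ x ∈ univ.filter (fun x => δ / 2 ≤ f x), f x ≤ A.card := by
    have : ∑ x ∈ A, f x ≤ ∑ _x ∈ A, (1 : ℝ) := sum_le_sum fun x _ => hf1 x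
    rwa [sum_const, nsmul_eq_mul, mul_one] at this
  have h2 : ∑ x ∈ univ.filter (fun x => ¬ δ / 2 ≤ f x), f x ≤ N * (δ / 2) := by
    have : ∑ x ∈ univ.filter (fun x => ¬ δ / 2 ≤ f x), f x ≤
        ∑ _x ∈ univ.filter (fun x => ¬ δ / 2 ≤ f x), δ / 2 :=
      sum_le_sum fun x hx => (not_le.mp (mem_filter.mp hx).2).le
    refine this.trans ?_
    rw [sum_const, nsmul_eq_mul]
    refine mul_le_mul_of_nonneg_right ?_ (by positivity)
    exact_mod_cast (card_filter_le _ _).trans (by rw [card_univ, ZMod.card])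
  linarith [hsplit, h1, h2]


/-- The display `𝔼[f(x)f(x+d)f(x+2d)] ≥ (δ/2)³ 𝔼[1_A(x)1_A(x+d)1_A(x+2d)]` of CFZ p. 7, for
general `k` and pointwise: for `A = {f ≥ δ/2}` and `f ≥ 0`,
`(δ/2)^k 1[(x,r) ∈ apPairs A] ≤ ∏_i f(x + i r)`. [cite: ConlonFoxZhao2014, Section 3 (p. 7)] -/
theorem pow_mul_indicator_le {δ : ℝ} (hδ : 0 ≤ δ) (f : ZMod N → ℝ) (hf0 : ∀ x, 0 ≤ f x)
    (x r : ZMod N) :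
    (δ / 2) ^ k *
        (if (x, r) ∈ Varnavides.apPairs k (univ.filter fun y => δ / 2 ≤ f y) then 1 else 0) ≤
      ∏ i : Fin k, f (x + ((i : ℕ) : ZMod N) * r) := by
  classical
  split_ifs with h
  · rw [mul_one]
    simp only [Varnavides.apPairs, mem_filter, mem_univ, true_and] at h
    calc (δ / 2) ^ k = ∏ _i : Fin k, (δ / 2) := by rw [prod_const, card_univ, Fintype.card_fin]
      _ ≤ ∏ i : Fin k, f (x + ((i : ℕ) : ZMod N) * r) :=
          prod_le_prod (fun i _ => by positivity) (fun i _ => h i)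
  · rw [mul_zero]; exact prod_nonneg fun i _ => hf0 _

end weighted

/-- **The weighted Szemerédi theorem at length `k` from the finitary one** (CFZ Thm. 3.1 ⇒ 3.2 ⇒
3.3, run for general `k`: Varnavides' averaging, then, paraphrasing p. 7, `A = {x : f(x) ≥ δ/2}`
has `|A| ≥ δN/2`, so `𝔼[f(x) ⋯ f(x+(k-1)d)] ≥ (δ/2)^k 𝔼[1_A(x) ⋯ 1_A(x+(k-1)d)]`, which the
counting version bounds below by a positive constant for `N` large). The constant is
`(δ/2)^k · c(k, δ/2)` with `c` from `Varnavides.le_card_apPairs`; the bound holds outright (no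
`o(1)`) for `N ≥ N₀`. [cite: ConlonFoxZhao2014, Theorems 3.2–3.3 and 4.1] -/
theorem szemerediWeighted_of_finitary {k : ℕ} (hS : SzemerediFinitary k) : SzemerediWeighted k := by
  intro δ hδ _hδ1
  obtain ⟨c₀, hc₀, N₀, hN₀⟩ := Varnavides.le_card_apPairs hS (half_pos hδ)
  refine ⟨(δ / 2) ^ k * c₀, by positivity, fun η hη => ?_⟩
  filter_upwards [eventually_ge_atTop N₀] with N hN
  intro _ f hf0 hf1 hfδ
  classical
  set A : Finset (ZMod N) := univ.filter fun y => δ / 2 ≤ f y with hA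
  have hAcard : δ / 2 * N ≤ A.card := le_card_filter_of_expect hδ.le f hf1 hfδ
  have hP : c₀ * (N : ℝ) ^ 2 ≤ (Varnavides.apPairs k A).card := hN₀ N hN A hAcard
  have hNpos : (0 : ℝ) < N := by exact_mod_cast Nat.pos_of_ne_zero (NeZero.ne N)
  have h1 : (δ / 2) ^ k * c₀ ≤ 𝔼 x : ZMod N, 𝔼 r : ZMod N,
      (δ / 2) ^ k * (if (x, r) ∈ Varnavides.apPairs k A then 1 else 0 : ℝ) := by
    rw [expect_expect_eq_sum_div, ← mul_sum, le_div_iff₀ (by positivity)]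
    simp only [Prod.mk.eta, sum_boole, filter_univ_mem]
    rw [mul_assoc]
    exact mul_le_mul_of_nonneg_left hP (by positivity)
  have h2 : 𝔼 x : ZMod N, 𝔼 r : ZMod N,
      (δ / 2) ^ k * (if (x, r) ∈ Varnavides.apPairs k A then 1 else 0 : ℝ) ≤
      𝔼 x : ZMod N, 𝔼 r : ZMod N, ∏ i : Fin k, f (x + ((i : ℕ) : ZMod N) * r) :=
    expect_le_expect fun x _ => expect_le_expect fun r _ => pow_mul_indicator_le hδ.le f hf0 x r
  linarith [h1, h2]

/-- **CFZ Theorem 3.3 (Roth's theorem, weighted version), unconditionally**: for every `δ > 0`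
there is `c(δ) > 0` with `𝔼_{x,d ∈ ℤ_N}[f(x) f(x+d) f(x+2d)] ≥ c - o_δ(1)` for all
`f : ℤ_N → [0,1]` with `𝔼 f ≥ δ`. From Mathlib's Roth theorem via Varnavides.
[cite: ConlonFoxZhao2014, Theorem 3.3] -/
theorem szemerediWeighted_three : SzemerediWeighted 3 :=
  szemerediWeighted_of_finitary szemerediFinitary_three

/-- The weighted statement at lengths `k ≤ 2` (trivial progressions). [folklore] -/
theorem szemerediWeighted_of_le_two {k : ℕ} (hk : k ≤ 2) : SzemerediWeighted k :=
  szemerediWeighted_of_finitary (szemerediFinitary_of_le_two hk)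

/-! ### The converse: the weighted form gives back the finitary form (CFZ §2) -/

namespace Varnavides

variable {k : ℕ} {N : ℕ} [NeZero N]

/-- No wrap-around, forward case: if `x, x+r, …` all have representatives `< M`, `N = 2M`, and
`r` has representative `ρ < M`, then the representatives form the progression `a + iρ`.
[folklore] -/
theorem val_add_mul_eq_of_lt {M : ℕ} (hN : N = 2 * M) (x r : ZMod N) (hr : r.val < M)
    (hA : ∀ i < k, (x + ((i : ℕ) : ZMod N) * r).val < M) :
    ∀ i < k, (x + ((i : ℕ) : ZMod N) * r).val = x.val + i * r.val := by
  intro i hi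
  induction i with
  | zero => simp
  | succ i ih =>
    have ih' := ih (Nat.lt_of_succ_lt hi)
    have hlt := hA i (Nat.lt_of_succ_lt hi)
    have e : x + (((i + 1 : ℕ) : ℕ) : ZMod N) * r = (x + ((i : ℕ) : ZMod N) * r) + r := by
      push_cast; ring
    rw [ih'] at hlt
    rw [e, ZMod.val_add, ih', Nat.mod_eq_of_lt (by omega)]
    ring

/-- No wrap-around, backward case: if `x, x+r, …` all have representatives `< M`, `N = 2M`, and
`r` has representative `ρ ≥ M`, then with `σ = N - ρ ∈ (0, M]` the representatives form the
descending progression `a - iσ` (and `iσ ≤ a`). [folklore] -/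
theorem val_add_mul_eq_of_le {M : ℕ} (hN : N = 2 * M) (x r : ZMod N) (hr : M ≤ r.val)
    (hA : ∀ i < k, (x + ((i : ℕ) : ZMod N) * r).val < M) :
    ∀ i < k, i * (N - r.val) ≤ x.val ∧
      (x + ((i : ℕ) : ZMod N) * r).val = x.val - i * (N - r.val) := by
  have hrN : r.val < N := ZMod.val_lt r
  have hxN : x.val < N := ZMod.val_lt x
  intro i hi
  induction i with
  | zero => simp
  | succ i ih =>
    obtain ⟨ih1, ih2⟩ := ih (Nat.lt_of_succ_lt hi)
    have hlt := hA i (Nat.lt_of_succ_lt hi)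
    have hlt' := hA (i + 1) hi
    have e : x + (((i + 1 : ℕ) : ℕ) : ZMod N) * r = (x + ((i : ℕ) : ZMod N) * r) + r := by
      push_cast; ring
    rw [e, ZMod.val_add, ih2] at hlt' ⊢
    -- the sum `s = (a - iσ) + ρ` lies in `[M, N + M)`; its residue is `< M`, so `s ≥ N`
    set s := x.val - i * (N - r.val) + r.val with hs
    have hsN : N ≤ s := by
      by_contra h
      push Not at h
      rw [Nat.mod_eq_of_lt h] at hlt'
      omega
    have hs2 : s < 2 * N := by omega
    have hmod : s % N = s - N := by
      rw [Nat.mod_eq_sub_mod hsN, Nat.mod_eq_of_lt (by omega)]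
    rw [hmod]
    constructor
    · -- `(i+1) σ ≤ a`
      have : N - r.val ≤ x.val - i * (N - r.val) := by omega
      calc (i + 1) * (N - r.val) = i * (N - r.val) + (N - r.val) := by ring
        _ ≤ x.val := by omega
    · have e2 : (i + 1) * (N - r.val) = i * (N - r.val) + (N - r.val) := by ring
      rw [e2]
      omega

/-- The indicator of (the image of) `A ⊆ range M` in `ℤ_N`, `M ≤ N`, has exactly `|A|` points.
[folklore] -/
theorem card_filter_val_mem {M : ℕ} (hMN : M ≤ N) {A : Finset ℕ} (hA : A ⊆ range M) :
    (univ.filter fun x : ZMod N => x.val ∈ A).card = A.card := by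
  classical
  refine Finset.card_bij (fun x _ => x.val) (fun x hx => (mem_filter.mp hx).2)
    (fun x _ y _ h => ZMod.val_injective N h) (fun a ha => ?_)
  have haN : a < N := lt_of_lt_of_le (mem_range.mp (hA ha)) hMN
  refine ⟨(a : ZMod N), ?_, ?_⟩
  · rw [mem_filter, ZMod.val_natCast, Nat.mod_eq_of_lt haN]; exact ⟨mem_univ _, ha⟩
  · rw [ZMod.val_natCast, Nat.mod_eq_of_lt haN]

end Varnavides

/-- **The finitary form back from the weighted form** (CFZ §2–§3: the `ℤ_N` and `[N]` settings "are
roughly equivalent for studying `k`-APs … one simply embeds `[N]` into a slightly larger cyclic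
group so that no `k`-APs wrap around zero"; and "when `f = 1_A` … this reduces to the counting
version"). Here `[M]` is embedded in `ℤ_{2M}`; a pair `(x, r)` with `r ≠ 0` exists once
`c N² > N`, and a progression of `ℤ_{2M}` all of whose terms have representatives `< M` is a genuine
progression of integers (read forwards if `r < M`, backwards if `r ≥ M`). Hence
`SzemerediFinitary k ↔ SzemerediWeighted k`.
[cite: ConlonFoxZhao2014, Section 2 and Theorems 3.3/4.1] -/
theorem szemerediFinitary_of_weighted {k : ℕ} (hW : SzemerediWeighted k) : SzemerediFinitary k := by
  classical
  intro δ hδ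
  -- the weighted theorem at density `min δ 1 / 2`
  set δ₁ : ℝ := min δ 1 / 2 with hδ₁
  have hδ₁pos : 0 < δ₁ := by positivity
  have hδ₁le : δ₁ ≤ 1 := by
    have : min δ 1 ≤ 1 := min_le_right _ _
    rw [hδ₁]; linarith
  obtain ⟨c, hc, hc'⟩ := hW δ₁ hδ₁pos hδ₁le
  obtain ⟨N₁, hN₁⟩ := eventually_atTop.mp (hc' (c / 2) (half_pos hc))
  refine ⟨max N₁ (⌊2 / c⌋₊ + 1), fun M hM A hAM hAcard => ?_⟩
  have hMN₁ : N₁ ≤ M := le_of_max_le_left hM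
  have hMc : 2 / c < M := by
    have h1 : 2 / c < (⌊2 / c⌋₊ : ℝ) + 1 := Nat.lt_floor_add_one _
    have h2 : (⌊2 / c⌋₊ : ℝ) + 1 ≤ M := by exact_mod_cast le_of_max_le_right hM
    exact h1.trans_le h2
  have hMpos : 0 < M := by
    have : (0 : ℝ) < M := lt_trans (by positivity) hMc
    exact_mod_cast this
  rcases Nat.eq_zero_or_pos k with hk0 | hkpos
  · exact ⟨0, 1, Nat.one_pos, fun j hj => absurd hj (by omega)⟩
  -- the modulus `N = 2M` and the indicator `f` of `A`
  set N : ℕ := 2 * M with hNdef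
  haveI : NeZero N := ⟨by omega⟩
  set f : ZMod N → ℝ := fun x => if x.val ∈ A then 1 else 0 with hfdef
  have hf0 : ∀ x, 0 ≤ f x := fun x => by simp only [hfdef]; split_ifs <;> norm_num
  have hf1 : ∀ x, f x ≤ 1 := fun x => by simp only [hfdef]; split_ifs <;> norm_num
  have hNpos : (0 : ℝ) < N := by exact_mod_cast (show 0 < N by omega)
  have hMposR : (0 : ℝ) < M := by exact_mod_cast hMpos
  have hNR : (N : ℝ) = 2 * M := by rw [hNdef]; norm_num
  -- `𝔼 f = |A| / (2M) ≥ δ₁`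
  have hEf : δ₁ ≤ 𝔼 x, f x := by
    rw [Fintype.expect_eq_sum_div_card, ZMod.card, le_div_iff₀ hNpos]
    simp only [hfdef, sum_boole]
    rw [Varnavides.card_filter_val_mem (by omega) hAM, hNR, hδ₁]
    have : min δ 1 * M ≤ A.card :=
      (mul_le_mul_of_nonneg_right (min_le_left _ _) (Nat.cast_nonneg M)).trans hAcard
    linarith
  -- the weighted theorem: `c/2 ≤ #apPairs / N²`
  have hlow := hN₁ N (by omega) f hf0 hf1 hEf
  set Af : Finset (ZMod N) := univ.filter fun x => x.val ∈ A with hAf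
  have hprod : ∀ x r : ZMod N, (∏ i : Fin k, f (x + ((i : ℕ) : ZMod N) * r)) =
      if (x, r) ∈ Varnavides.apPairs k Af then 1 else 0 := by
    intro x r
    by_cases h : ∀ i : Fin k, (x + ((i : ℕ) : ZMod N) * r).val ∈ A
    · rw [if_pos (by simpa [Varnavides.apPairs, hAf] using h)]
      exact Finset.prod_eq_one fun i _ => by simp [hfdef, h i]
    · rw [if_neg (by simpa [Varnavides.apPairs, hAf] using h)]
      obtain ⟨i, hi⟩ := not_forall.mp h
      exact Finset.prod_eq_zero (mem_univ i) (by simp [hfdef, hi])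
  simp_rw [hprod] at hlow
  rw [expect_expect_eq_sum_div] at hlow
  simp only [Prod.mk.eta, sum_boole, filter_univ_mem] at hlow
  -- `#apPairs ≥ (c/2) N² > N`, so some pair has `r ≠ 0`
  have hcard : (N : ℝ) < (Varnavides.apPairs k Af).card := by
    have h1 : c / 2 * (N : ℝ) ^ 2 ≤ (Varnavides.apPairs k Af).card := by
      have := hlow
      rw [sub_half, le_div_iff₀ (by positivity)] at this
      exact this
    have hcM : 2 < c * M := by
      have := hMc
      rw [div_lt_iff₀ hc, mul_comm] at this
      exact this
    have h2 : (N : ℝ) < c / 2 * (N : ℝ) ^ 2 := by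
      rw [hNR]
      have h3 : (2 : ℝ) * M < c * M * M := by nlinarith [mul_lt_mul_of_pos_right hcM hMposR]
      have h4 : c / 2 * (2 * (M : ℝ)) ^ 2 = 2 * (c * M * M) := by ring
      have h5 : (0 : ℝ) ≤ c * M * M := by positivity
      rw [h4]; linarith
    exact h2.trans_le h1
  obtain ⟨p, hp, hp2⟩ : ∃ p ∈ Varnavides.apPairs k Af, p.2 ≠ 0 := by
    by_contra h
    push Not at h
    have hsub : Varnavides.apPairs k Af ⊆ (univ : Finset (ZMod N)).map
        ⟨fun x => (x, (0 : ZMod N)), fun x y hxy => (Prod.ext_iff.mp hxy).1⟩ := by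
      intro p hp
      rw [Finset.mem_map]
      exact ⟨p.1, mem_univ _, Prod.ext rfl (h p hp).symm⟩
    have := card_le_card hsub
    rw [card_map, card_univ, ZMod.card] at this
    exact absurd hcard (not_lt.mpr (by exact_mod_cast this))
  -- all terms of the progression of `p` have representatives in `A ⊆ range M`
  have hmem : ∀ i < k, (p.1 + ((i : ℕ) : ZMod N) * p.2).val ∈ A := by
    intro i hi
    have := (mem_filter.mp hp).2 ⟨i, hi⟩
    simpa [hAf] using this
  have hltM : ∀ i < k, (p.1 + ((i : ℕ) : ZMod N) * p.2).val < M := fun i hi =>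
    mem_range.mp (hAM (hmem i hi))
  have hρpos : 0 < p.2.val := by
    rw [Nat.pos_iff_ne_zero]; exact fun h => hp2 ((ZMod.val_eq_zero p.2).mp h)
  rcases Nat.lt_or_ge p.2.val M with hρ | hρ
  · -- forwards
    refine ⟨p.1.val, p.2.val, hρpos, fun j hj => ?_⟩
    rw [← Varnavides.val_add_mul_eq_of_lt hNdef p.1 p.2 hρ hltM j hj]
    exact hmem j hj
  · -- backwards, with `σ = N - ρ`
    have hσpos : 0 < N - p.2.val := Nat.sub_pos_of_lt (ZMod.val_lt p.2)
    have hback := Varnavides.val_add_mul_eq_of_le hNdef p.1 p.2 hρ hltM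
    obtain ⟨hk1, -⟩ := hback (k - 1) (by omega)
    refine ⟨p.1.val - (k - 1) * (N - p.2.val), N - p.2.val, hσpos, fun j hj => ?_⟩
    obtain ⟨h1, h2⟩ := hback (k - 1 - j) (by omega)
    have e : p.1.val - (k - 1) * (N - p.2.val) + j * (N - p.2.val) =
        p.1.val - (k - 1 - j) * (N - p.2.val) := by
      have e1 : (k - 1) * (N - p.2.val) = (k - 1 - j) * (N - p.2.val) + j * (N - p.2.val) := by
        rw [← Nat.add_mul]; congr 1; omega
      omega
    rw [e, ← h2]
    exact hmem _ (by omega)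

/-- The two forms of Szemerédi's theorem at length `k` are equivalent.
[cite: ConlonFoxZhao2014, Section 2 and Theorems 3.1–3.3/4.1] -/
theorem szemerediFinitary_iff_weighted {k : ℕ} : SzemerediFinitary k ↔ SzemerediWeighted k :=
  ⟨szemerediWeighted_of_finitary, szemerediFinitary_of_weighted⟩

/-! ### Bridges to the bundled named fact `SzemerediTheorem` -/

/-- The bundled named fact `SzemerediTheorem` (file `SzemerediTheorem.lean`, Szemerédi 1975 as
printed in Polymath 2012, Thm. 1.2) is by `rfl` the conjunction of the slices
`SzemerediFinitary k`, `k ≥ 1`. [cite: Szemeredi1975, Main Theorem] -/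
theorem szemerediTheorem_iff : SzemerediTheorem ↔ ∀ k : ℕ, 1 ≤ k → SzemerediFinitary k :=
  Iff.rfl

/-- Each slice from the bundle (`k = 0` being trivial). [cite: Szemeredi1975, Main Theorem] -/
theorem szemerediFinitary_of_szemerediTheorem (h : SzemerediTheorem) (k : ℕ) :
    SzemerediFinitary k := by
  rcases Nat.eq_zero_or_pos k with hk | hk
  · subst hk; exact szemerediFinitary_of_le_two (by omega)
  · exact h k hk

/-- The weighted form at every length from the bundled Szemerédi theorem (Varnavides and the
passage to weights). [cite: ConlonFoxZhao2014, Theorem 4.1] -/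
theorem szemerediWeighted_of_szemerediTheorem (h : SzemerediTheorem) (k : ℕ) :
    SzemerediWeighted k :=
  szemerediWeighted_of_finitary (szemerediFinitary_of_szemerediTheorem h k)

/-- Conversely, the weighted forms at all lengths `k ≥ 3` give back the bundled Szemerédi theorem
(`k ≤ 2` is trivial). [cite: ConlonFoxZhao2014, Section 2 and Theorem 4.1] -/
theorem szemerediTheorem_of_weighted (h : ∀ k : ℕ, 3 ≤ k → SzemerediWeighted k) :
    SzemerediTheorem := by
  intro k _hk
  by_cases hk3 : 3 ≤ k
  · exact szemerediFinitary_of_weighted (h k hk3)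
  · exact szemerediFinitary_of_le_two (by omega)

end Literature.Combinatorics.Additive
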